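import Summits.BirchSwinnertonDyer.BirchSwinnertonDyer.Theorems.ByReductionTypeAtTwoSL2ZTorsion
import HarnessLib

/-!
# Route `ByReductionTypeAtTwo` (K4), crux `OrdMissingLowerBoundAtTwo` (stmt-BirchSwinnertonDyer-19577), line
# `kato-free-lower-sandwich-two` — the flat witness (W) AT EVERY PRIME LEVEL
# (`--supports`, helper; prepares skeleton v9: the registered stub `stub_flatWitnessAtTwo` shrinks to composite levels)

Cell `bsd-2adic`, lead `cruxlead-stmt-BirchSwinnertonDyer-19577` (g2).  THEOREMS ONLY — no definition, no named fact, no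
`sorry`; closes nothing; BSD is not proved by any of this.

The registered stub (W) `stub_flatWitnessAtTwo` of skeleton v8 (`Cruxes/OrdMissingLowerBoundAtTwo/Lines/kato_free_lower_sandwich_two.lean`)
asks, at every odd level `N`, for an admissible subgroup `H ≤ (ℤ/N)ˣ` (`−1 ∈ H`, `d(γ) mod N ∈ H` for every finite-order or
trace-`±2` element `γ ∈ Γ₀(N)`) and an element `ρ` of `⟨finite-order, trace ±2⟩ ⊔ [Γ₀(N), Γ₀(N)]` with `|d(ρ)| = 2ᵏ` and
`gcd(k, 4) ∣ e` whenever `2ᵉ ∈ H`.  This file proves it at every PRIME level `p ≠ 2` (and at `N = 1`), with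
`H = {u : u¹² = 1}` and a SINGLE elliptic or parabolic witness (`ByReductionTypeAtTwoSL2ZTorsion`):
`flatWitnessAtTwo_prime` — for a prime `p ≠ 2` let `r` be the order of `2¹²` in `(ℤ/p)ˣ` (so `2ᵉ ∈ H ⟺ r ∣ e`); then
`ζ = 2ʳ` is a 12-th root of unity in `𝔽_p`, i.e. `ζ = ±1` (parabolic witness, `d = 2ʳ`), or `ζ² = −1` / `ζ² ± ζ + 1 = 0`
(elliptic witness of order `4` / `3` / `6`, `d = 2ʳ`), or `ζ⁴ − ζ² + 1 = 0` (then `(ζ³)² = −1`: elliptic witness of order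
`4`, `d = 2^{3r}`); in every case `gcd(k, 4) ∣ r ∣ e`.  `flatWitnessAtTwo_one` is the level-`1` case and
`flatWitnessAtTwo_of_composite` reduces the stub to composite odd levels `N > 1` (certified by kit at every odd `N ≤ 30000`;
the 196 levels `≤ 30000` needing a product of two order-`4` elements are all squarefree products of primes `≡ 1 (mod 4)` —
crux-triage r1-2, `TRIAGE-r1-2.md` §N2; no uniform proof is known on that family).
-/

set_option linter.dupNamespace false
set_option autoImplicit false

namespace Summit.BirchSwinnertonDyer.BirchSwinnertonDyer.Theorems.FlatWitnessTwo

open scoped MatrixGroups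
open CongruenceSubgroup Literature.NumberTheory.EllipticCurves.Rank1Residual
  Literature.NumberTheory.EllipticCurves.ModularForms

/-! ## §3 The flat witness at prime level -/

section Prime

/-- **Packaging a SINGLE WITNESS**: an admissible `H`, one killed element `ρ` (finite order or trace `±2`) with
`|d(ρ)| = 2ᵏ`, and `gcd(k, 4) ∣ e` whenever `2ᵉ ∈ H`, give the flat witness (W) at level `N`. [cite: Manin1972, Prop. 1.4] -/
theorem flatWitnessAt_of_single {N : ℕ} (H : Subgroup (ZMod N)ˣ) (hneg : -1 ∈ H)
    (hH : ∀ γ : Gamma0 N, IsOfFinOrder γ ∨ trEntry γ = 2 ∨ trEntry γ = -2 → ∃ u ∈ H, (u : ZMod N) = Gamma0Map N γ)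
    (ρ : Gamma0 N) (hρ : IsOfFinOrder ρ ∨ trEntry ρ = 2 ∨ trEntry ρ = -2) (k : ℕ) (hk : (dEntry ρ).natAbs = 2 ^ k)
    (hdiv : ∀ e : ℕ, (∃ u ∈ H, (u : ZMod N) = 2 ^ e) → Nat.gcd k 4 ∣ e) :
    ∃ (H : Subgroup (ZMod N)ˣ) (ρ : Gamma0 N) (k : ℕ), -1 ∈ H ∧
      (∀ γ : Gamma0 N, IsOfFinOrder γ ∨ trEntry γ = 2 ∨ trEntry γ = -2 → ∃ u ∈ H, (u : ZMod N) = Gamma0Map N γ) ∧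
      ρ ∈ Subgroup.closure {γ : Gamma0 N | IsOfFinOrder γ ∨ trEntry γ = 2 ∨ trEntry γ = -2} ⊔ commutator (Gamma0 N) ∧
      (dEntry ρ).natAbs = 2 ^ k ∧
      ∀ e : ℕ, (∃ u ∈ H, (u : ZMod N) = 2 ^ e) → Nat.gcd k 4 ∣ e :=
  ⟨H, ρ, k, hneg, hH, Subgroup.mem_sup_left (Subgroup.subset_closure hρ), hk, hdiv⟩

/-- **(W) at every odd PRIME level.**  `H = {u ∈ (ℤ/p)ˣ : u¹² = 1}` is admissible (`gamma0Map_pow_twelve_of_isOfFinOrder`,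
`gamma0Map_eq_of_trEntry`); with `r` the order of `2¹²` in `(ℤ/p)ˣ` (so `2ᵉ ∈ H ⟺ r ∣ e`), `ζ = 2ʳ` is a 12-th root of
unity in `𝔽_p`, and `ζ = 1`, `ζ = −1`, `ζ² + 1 = 0`, `ζ² + ζ + 1 = 0`, `ζ² − ζ + 1 = 0`, `ζ⁴ − ζ² + 1 = 0` give respectively a
parabolic, parabolic, order-`4`, order-`3`, order-`6` witness with `d = 2ʳ` (`k = r`) and an order-`4` witness with
`d = 2^{3r}` (`k = 3r`, `(ζ³)² = −1`); `gcd(k, 4) ∣ r`. [cite: Manin1972, Prop. 1.4] -/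
theorem flatWitnessAtTwo_prime (p : ℕ) (hp : p.Prime) (hp2 : p ≠ 2) :
    ∃ (H : Subgroup (ZMod p)ˣ) (ρ : Gamma0 p) (k : ℕ), -1 ∈ H ∧
      (∀ γ : Gamma0 p, IsOfFinOrder γ ∨ trEntry γ = 2 ∨ trEntry γ = -2 → ∃ u ∈ H, (u : ZMod p) = Gamma0Map p γ) ∧
      ρ ∈ Subgroup.closure {γ : Gamma0 p | IsOfFinOrder γ ∨ trEntry γ = 2 ∨ trEntry γ = -2} ⊔ commutator (Gamma0 p) ∧
      (dEntry ρ).natAbs = 2 ^ k ∧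
      ∀ e : ℕ, (∃ u ∈ H, (u : ZMod p) = 2 ^ e) → Nat.gcd k 4 ∣ e := by
  haveI : Fact p.Prime := ⟨hp⟩
  -- the admissible subgroup `H = ker (u ↦ u¹²)`
  set H : Subgroup (ZMod p)ˣ := (powMonoidHom 12 : (ZMod p)ˣ →* (ZMod p)ˣ).ker with hHdef
  have hmemH : ∀ u : (ZMod p)ˣ, u ∈ H ↔ u ^ 12 = 1 := fun u => by
    rw [hHdef, MonoidHom.mem_ker, powMonoidHom_apply]
  have hneg : -1 ∈ H := by rw [hmemH]; norm_num
  have hH : ∀ γ : Gamma0 p, IsOfFinOrder γ ∨ trEntry γ = 2 ∨ trEntry γ = -2 →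
      ∃ u ∈ H, (u : ZMod p) = Gamma0Map p γ := by
    intro γ hγ
    obtain ⟨u, hu⟩ := isUnit_Gamma0Map p γ
    refine ⟨u, ?_, hu⟩
    rw [hmemH]
    ext
    rw [Units.val_pow_eq_pow_val, hu, Units.val_one]
    rcases hγ with h | h
    · exact gamma0Map_pow_twelve_of_isOfFinOrder γ h
    · rcases gamma0Map_eq_of_trEntry γ h with h1 | h1 <;> rw [h1] <;> norm_num
  -- the unit `2` and the order `r` of `2¹²`
  have hcop : Nat.Coprime 2 p := (Nat.coprime_primes Nat.prime_two hp).mpr (Ne.symm hp2)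
  set t : (ZMod p)ˣ := ZMod.unitOfCoprime 2 hcop with htdef
  have ht : (t : ZMod p) = 2 := by rw [htdef, ZMod.coe_unitOfCoprime]; norm_num
  set r : ℕ := orderOf (t ^ 12) with hrdef
  have hr : 0 < r := orderOf_pos (t ^ 12)
  have hkey : ∀ e : ℕ, (∃ u ∈ H, (u : ZMod p) = 2 ^ e) → r ∣ e := by
    rintro e ⟨u, huH, hu⟩
    have hut : u = t ^ e := Units.ext (by rw [hu, Units.val_pow_eq_pow_val, ht])
    rw [hut, hmemH, ← pow_mul, mul_comm, pow_mul] at huH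
    exact orderOf_dvd_of_pow_eq_one huH
  -- `ζ = 2^r` is a 12-th root of unity in `𝔽_p`
  set z : ZMod p := (2 : ZMod p) ^ r with hzdef
  have hz12 : z ^ 12 = 1 := by
    have h1 : (t ^ 12) ^ r = 1 := pow_orderOf_eq_one (t ^ 12)
    have h2 := congrArg (fun u : (ZMod p)ˣ => (u : ZMod p)) h1
    simp only [Units.val_pow_eq_pow_val, ht, Units.val_one] at h2
    rw [hzdef, ← pow_mul, mul_comm, pow_mul, h2]
  have hfac : (z - 1) * (z + 1) * (z ^ 2 + 1) * (z ^ 2 + z + 1) * (z ^ 2 - z + 1) * (z ^ 4 - z ^ 2 + 1) = 0 := by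
    have : (z - 1) * (z + 1) * (z ^ 2 + 1) * (z ^ 2 + z + 1) * (z ^ 2 - z + 1) * (z ^ 4 - z ^ 2 + 1) = z ^ 12 - 1 := by
      ring
    rw [this, hz12, sub_self]
  -- integer lifts: `z = ((2:ℤ)^r : ZMod p)`, `z^3 = ((2:ℤ)^(3r) : ZMod p)`
  set D : ℤ := (2 : ℤ) ^ r with hDdef
  set D3 : ℤ := (2 : ℤ) ^ (3 * r) with hD3def
  have hDz : ((D : ℤ) : ZMod p) = z := by rw [hDdef, hzdef]; push_cast; rfl
  have hD3z : ((D3 : ℤ) : ZMod p) = z ^ 3 := by rw [hD3def, hzdef, ← pow_mul, mul_comm]; push_cast; rfl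
  have hDabs : D.natAbs = 2 ^ r := by rw [hDdef, Int.natAbs_pow]; rfl
  have hD3abs : D3.natAbs = 2 ^ (3 * r) := by rw [hD3def, Int.natAbs_pow]; rfl
  -- a divisibility `p ∣ x` in `ℤ` from a vanishing in `𝔽_p`
  have hdvd : ∀ x : ℤ, ((x : ℤ) : ZMod p) = 0 → ∃ n : ℤ, x = n * p := by
    intro x hx
    obtain ⟨c, hc⟩ := (ZMod.intCast_zmod_eq_zero_iff_dvd x p).mp hx
    exact ⟨c, by rw [hc, mul_comm]⟩
  -- `gcd(k, 4) ∣ r` for `k = r` and `k = 3r`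
  have hgcd1 : Nat.gcd r 4 ∣ r := Nat.gcd_dvd_left r 4
  have hgcd3 : Nat.gcd (3 * r) 4 ∣ r := by
    have h4 : Nat.gcd (3 * r) 4 ∣ 4 := Nat.gcd_dvd_right _ _
    have hc : Nat.Coprime (Nat.gcd (3 * r) 4) 3 :=
      Nat.Coprime.coprime_dvd_left h4 (by norm_num : Nat.Coprime 4 3)
    exact hc.dvd_of_dvd_mul_left (Nat.gcd_dvd_left _ _)
  -- case analysis on the 12-th root of unity `z`
  simp only [mul_eq_zero] at hfac
  rcases hfac with ((((h1 | h1) | h1) | h1) | h1) | h1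
  · -- `z = 1`: parabolic witness of trace `2`, `d = 2^r`
    have hx : (((D - 1 : ℤ)) : ZMod p) = 0 := by push_cast; rw [hDz]; exact h1
    obtain ⟨n, hn⟩ := hdvd _ hx
    have hsq : (p : ℤ) ∣ (D - 1) ^ 2 := Dvd.dvd.pow ⟨n, by rw [hn, mul_comm]⟩ two_ne_zero
    obtain ⟨ρ, hρtr, hρd⟩ := exists_parabolic_dEntry p D 1 (Or.inl rfl) hsq
    exact flatWitnessAt_of_single H hneg hH ρ (Or.inr (Or.inl (by rw [hρtr]; norm_num))) r
      (by rw [hρd, hDabs]) (fun e he => hgcd1.trans (hkey e he))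
  · -- `z = -1`: parabolic witness of trace `-2`, `d = 2^r`
    have hx : (((D - (-1) : ℤ)) : ZMod p) = 0 := by push_cast; rw [hDz]; linear_combination h1
    obtain ⟨n, hn⟩ := hdvd _ hx
    have hsq : (p : ℤ) ∣ (D - (-1)) ^ 2 := Dvd.dvd.pow ⟨n, by rw [hn, mul_comm]⟩ two_ne_zero
    obtain ⟨ρ, hρtr, hρd⟩ := exists_parabolic_dEntry p D (-1) (Or.inr rfl) hsq
    exact flatWitnessAt_of_single H hneg hH ρ (Or.inr (Or.inr (by rw [hρtr]; norm_num))) r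
      (by rw [hρd, hDabs]) (fun e he => hgcd1.trans (hkey e he))
  · -- `z² + 1 = 0`: elliptic witness of order `4`, `d = 2^r`
    have hx : (((D ^ 2 - 0 * D + 1 : ℤ)) : ZMod p) = 0 := by push_cast; rw [hDz]; linear_combination h1
    obtain ⟨n, hn⟩ := hdvd _ hx
    obtain ⟨ρ, hρfin, -, hρd⟩ := exists_elliptic_dEntry p D 0 n hn (by norm_num)
    exact flatWitnessAt_of_single H hneg hH ρ (Or.inl hρfin) r (by rw [hρd, hDabs])
      (fun e he => hgcd1.trans (hkey e he))
  · -- `z² + z + 1 = 0`: elliptic witness of order `3`, `d = 2^r`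
    have hx : (((D ^ 2 - (-1) * D + 1 : ℤ)) : ZMod p) = 0 := by push_cast; rw [hDz]; linear_combination h1
    obtain ⟨n, hn⟩ := hdvd _ hx
    obtain ⟨ρ, hρfin, -, hρd⟩ := exists_elliptic_dEntry p D (-1) n hn (by norm_num)
    exact flatWitnessAt_of_single H hneg hH ρ (Or.inl hρfin) r (by rw [hρd, hDabs])
      (fun e he => hgcd1.trans (hkey e he))
  · -- `z² - z + 1 = 0`: elliptic witness of order `6`, `d = 2^r`
    have hx : (((D ^ 2 - 1 * D + 1 : ℤ)) : ZMod p) = 0 := by push_cast; rw [hDz]; linear_combination h1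
    obtain ⟨n, hn⟩ := hdvd _ hx
    obtain ⟨ρ, hρfin, -, hρd⟩ := exists_elliptic_dEntry p D 1 n hn (by norm_num)
    exact flatWitnessAt_of_single H hneg hH ρ (Or.inl hρfin) r (by rw [hρd, hDabs])
      (fun e he => hgcd1.trans (hkey e he))
  · -- `z⁴ - z² + 1 = 0`: `(z³)² + 1 = 0`, elliptic witness of order `4`, `d = 2^{3r}`
    have h6 : (z ^ 3) ^ 2 + 1 = 0 := by linear_combination (z ^ 2 + 1) * h1
    have hx : (((D3 ^ 2 - 0 * D3 + 1 : ℤ)) : ZMod p) = 0 := by push_cast; rw [hD3z]; linear_combination h6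
    obtain ⟨n, hn⟩ := hdvd _ hx
    obtain ⟨ρ, hρfin, -, hρd⟩ := exists_elliptic_dEntry p D3 0 n hn (by norm_num)
    exact flatWitnessAt_of_single H hneg hH ρ (Or.inl hρfin) (3 * r) (by rw [hρd, hD3abs])
      (fun e he => hgcd3.trans (hkey e he))

/-- **(W) at level `1`** (the degenerate level allowed by `∀ N, Odd N`): the parabolic `(0, −1; 1, 2) ∈ Γ₀(1)` has `d = 2`,
`k = 1`, `H = ⊤`. [cite: Manin1972, Prop. 1.4] -/
theorem flatWitnessAtTwo_one :
    ∃ (H : Subgroup (ZMod 1)ˣ) (ρ : Gamma0 1) (k : ℕ), -1 ∈ H ∧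
      (∀ γ : Gamma0 1, IsOfFinOrder γ ∨ trEntry γ = 2 ∨ trEntry γ = -2 → ∃ u ∈ H, (u : ZMod 1) = Gamma0Map 1 γ) ∧
      ρ ∈ Subgroup.closure {γ : Gamma0 1 | IsOfFinOrder γ ∨ trEntry γ = 2 ∨ trEntry γ = -2} ⊔ commutator (Gamma0 1) ∧
      (dEntry ρ).natAbs = 2 ^ k ∧
      ∀ e : ℕ, (∃ u ∈ H, (u : ZMod 1) = 2 ^ e) → Nat.gcd k 4 ∣ e := by
  obtain ⟨ρ, hρtr, hρd⟩ := exists_parabolic_dEntry 1 2 1 (Or.inl rfl) (by norm_num)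
  refine flatWitnessAt_of_single ⊤ (Subgroup.mem_top _)
    (fun γ _ => ⟨(isUnit_Gamma0Map 1 γ).unit, Subgroup.mem_top _, (isUnit_Gamma0Map 1 γ).unit_spec⟩)
    ρ (Or.inr (Or.inl (by rw [hρtr]; norm_num))) 1 (by rw [hρd]; rfl) (fun e _ => by simp)

/-- **(W) reduces to COMPOSITE odd levels `N > 1`**: granted the flat witness at every composite odd `N > 1` (certified by
kit at every odd `N ≤ 30000`; open as a ∀-statement only on squarefree products of primes `≡ 1 (mod 4)`), (W) holds at every
odd level (`flatWitnessAtTwo_prime`, `flatWitnessAtTwo_one`). [cite: Manin1972, Prop. 1.4] -/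
theorem flatWitnessAtTwo_of_composite
    (hres : ∀ N : ℕ, Odd N → 1 < N → ¬ N.Prime →
      ∃ (H : Subgroup (ZMod N)ˣ) (ρ : Gamma0 N) (k : ℕ), -1 ∈ H ∧
      (∀ γ : Gamma0 N, IsOfFinOrder γ ∨ trEntry γ = 2 ∨ trEntry γ = -2 → ∃ u ∈ H, (u : ZMod N) = Gamma0Map N γ) ∧
      ρ ∈ Subgroup.closure {γ : Gamma0 N | IsOfFinOrder γ ∨ trEntry γ = 2 ∨ trEntry γ = -2} ⊔ commutator (Gamma0 N) ∧
      (dEntry ρ).natAbs = 2 ^ k ∧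
      ∀ e : ℕ, (∃ u ∈ H, (u : ZMod N) = 2 ^ e) → Nat.gcd k 4 ∣ e) :
    ∀ N : ℕ, Odd N →
      ∃ (H : Subgroup (ZMod N)ˣ) (ρ : Gamma0 N) (k : ℕ), -1 ∈ H ∧
      (∀ γ : Gamma0 N, IsOfFinOrder γ ∨ trEntry γ = 2 ∨ trEntry γ = -2 → ∃ u ∈ H, (u : ZMod N) = Gamma0Map N γ) ∧
      ρ ∈ Subgroup.closure {γ : Gamma0 N | IsOfFinOrder γ ∨ trEntry γ = 2 ∨ trEntry γ = -2} ⊔ commutator (Gamma0 N) ∧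
      (dEntry ρ).natAbs = 2 ^ k ∧
      ∀ e : ℕ, (∃ u ∈ H, (u : ZMod N) = 2 ^ e) → Nat.gcd k 4 ∣ e := by
  intro N hN
  rcases Nat.lt_or_ge 1 N with h1 | h1
  · by_cases hP : N.Prime
    · have hN2 : N ≠ 2 := by
        rintro rfl
        exact absurd hN (by decide)
      exact flatWitnessAtTwo_prime N hP hN2
    · exact hres N hN h1 hP
  · interval_cases N
    · exact absurd hN (by decide)
    · exact flatWitnessAtTwo_one

end Prime

end Summit.BirchSwinnertonDyer.BirchSwinnertonDyer.Theorems.FlatWitnessTwo
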